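import Literature.NumberTheory.EllipticCurves.GreenbergVatsal2000.ResidualLifting
import HarnessLib

/-!
# Greenberg–Vatsal 2000, §2 p. 28 with the PROOF on p. 30: the cohomology sequence of
# `0 → Φ → E[p] → Ψ → 0` over `ℚ_∞` is exact on the right for an EVEN line `Φ` — `H²(ℚ_Σ/ℚ_∞, Φ) = 0`
# "because `φ` is even" — WITHOUT the standing "`φ` ramified at `p`" of p. 28 (sibling of
# `ResidualLifting.lean`; the reading needed at an ADDITIVE prime `p = 3`, where the even line of the
# branch is unramified at `3`)

HONEST FRAMING (cell `bsd-addord`, home `run/shared/lean/pub/bsd-addord/`, seat `bsd-addord-twist`;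
FULL-BSD rank-`≤ 1` programme D-0033 tranche 1a, row B2 X3-share): the seat's kernel files
`Summits/…/Additive/X3BranchAlgebraicCountW[OfLifting].lean` prove Greenberg–Vatsal's count (16)+(11)
for `Sel_{p^∞}(E/ℚ_∞)` at an ADDITIVE potentially-good-ordinary prime from published records; the
residual LIFTING (every class of `U ⊂ H¹(ℚ_Σ/ℚ_∞, Ψ)` lifts to `H¹(ℚ_Σ/ℚ_∞, E[p])`) enters through the
tree's reading-fact `residualEpsilon_surjOn_of_lineRamifiedEven` (file `ResidualLifting`), which
carries GV's standing reduction of p. 28 "`φ` is ramified and even". At `p = 3` the even line of the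
branch-parity rows is UNRAMIFIED at `3`, and that record does not serve. THIS FILE records, as ONE
named reading-fact (`def … : Prop`, nothing asserted; D-0014/D-0026: exactly one new named fact, no
definition), the SAME printed statement read from its PROOF on p. 30, which uses of `φ` only that it
is EVEN (and that `Σ ⊇ Ram(E[p])`): the hypothesis `¬ LineUnramifiedAt` of the sibling is dropped,
everything else is identical. Nothing is booked by this file.

## Citation header (held text arXiv:math/9906215 = `paper:arxiv-math_9906215`; decoded copy
## `run/shared/lean/pub/bsd-addord/bsd-addord-twist-gv2000-decoded.txt`, chunks p0051–p0053 = pp. 28–30)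

* p. 28 (the displayed sequence, under the standing reduction): "One of the characters `φ` or `ψ` is
  even, one odd. One of these characters is ramified at `p`, the other unramified. We will assume
  that the ramified character is even … Thus, we may assume for our purpose that `φ` is ramified and
  even, `ψ` is unramified and odd. … Now `H⁰(ℚ_∞, Ψ) = 0`. Later we will show that
  `H²(ℚ_Σ/ℚ_∞, Φ) = 0`. Therefore, we have an exact sequence
  `0 → H¹(ℚ_Σ/ℚ_∞, Φ) → H¹(ℚ_Σ/ℚ_∞, E[p]) →ε H¹(ℚ_Σ/ℚ_∞, Ψ) → 0`. Now
  `S^{Σ₀}_{E[p]}(ℚ_∞) = ker(H¹(ℚ_Σ/ℚ_∞, E[p]) → H¹(I_p, Ψ))`. Hence `im(·) ⊂ S^{Σ₀}_{E[p]}(ℚ_∞) = ε⁻¹(U)`,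
  where `U = ker(H¹(ℚ_Σ/ℚ_∞, Ψ) → H¹(I_p, Ψ))`."
* p. 29 (the even case of a one-dimensional datum): "Assume first that `χ` is even. … We have `d⁺ = 1`
  and so we must take `W_p = V_p`. Therefore, `𝓗_p(ℚ_∞, A) = 0` and it follows that
  `S_A(ℚ_∞) = Hom_Δ(X_∞, A)` … The Ferrero-Washington theorem implies that the torsion `Λ`-module
  `(X_∞ ⊗ O)^θ` has `μ`-invariant equal to zero."
* **p. 30 (THE PROOF of `H² = 0`)**: "We must just explain why `H²(ℚ_Σ/ℚ_∞, Φ) = 0`. This is in fact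
  equivalent to the vanishing of the `μ`-invariant for the `Λ`-module `X^φ_∞`. We take `χ = φ`.
  Suppose that `A ≅ ℚ_p/ℤ_p` and that `G_ℚ` acts on `A` by `φ`. **Since `X^φ_∞` is `Λ`-torsion
  (because `φ` is even)**, it follows that `S_A(ℚ_∞)` and `S^{Σ₀}_A(ℚ_∞) = H¹(ℚ_Σ/ℚ_∞, A)` are
  `Λ`-cotorsion. Their `μ`-invariants are zero, by the Ferrero-Washington theorem. By proposition
  (2.5), `S^{Σ₀}_A(ℚ_∞)^` has no nonzero, finite `Λ`-submodules, which then implies that it is a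
  divisible group. That is, `H¹(ℚ_Σ/ℚ_∞, A)` is divisible. Also, `H²(ℚ_Σ/ℚ_∞, A)` must be
  `Λ`-cotorsion (using the first result about coranks recalled at the beginning of this section). By
  proposition 4 of [Gre99], it follows that `H²(ℚ_Σ/ℚ_∞, A) = 0`. Then the exact sequence
  `0 → Φ → A →p A → 0` induces an isomorphism `H¹(ℚ_Σ/ℚ_∞, A)/pH¹(ℚ_Σ/ℚ_∞, A) ≅ H²(ℚ_Σ/ℚ_∞, Φ)`. The
  vanishing of `H²(ℚ_Σ/ℚ_∞, Φ)` follows from this."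

READING (labelled, this seat's): the argument on p. 30 uses of the character `φ` of `Φ` only (i) that
it is EVEN ("because `φ` is even": `X^φ_∞` is `Λ`-torsion; Ferrero–Washington for the abelian field of
`φ`) and (ii) that `Ram(A_φ) ⊆ Σ = Σ₀ ∪ {p, ∞}` (for Prop. (2.5), whose other hypothesis "`D`
unramified" is void here since `d⁺ = d = 1`, `C = A`, `D = 0`, p. 29 "`W_p = V_p`"); the ramification
of `φ` AT `p` is not used. The standing reduction "`φ` ramified and even" of p. 28 is the WLOG step of
the proof of Thm. (1.3) (passing to `E/Φ` along the `p`-isogeny), not an input of the `H² = 0`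
argument. So the right-exactness of the displayed sequence — `ε` onto `H¹(ℚ_Σ/ℚ_∞, Ψ) ⊇ U` — is
PRINTED for every `E/ℚ` with `E[p] ⊇ Φ` a rational line with EVEN character, `p` odd, `Σ₀ ⊇` the
bad places `≠ p`.

## The tree's vocabulary (no new definition; as the sibling)

`E/ℚ` on a globally minimal model, `p` odd, `Φ₀ ≤ E[p]` a rational line which is EVEN
(`IsRationalLine`, `LineEven`; NO ramification hypothesis), `κ` the cyclotomic `ℤ_p`-extension,
`S₀ = Σ₀ ∌ p` finite containing the bad places `≠ p`; the groups of p. 28 as filed in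
`ResidualSelmerGroups.lean` (`residualTorsionH1`, `residualQuotSelmer`, `residualEpsilon`). The
statement filed is the surjectivity of `ε` read on `U`: every element of `residualQuotSelmer` lifts
to `residualTorsionH1`.
-/

set_option autoImplicit false

noncomputable section

open scoped Classical AddSubgroup

open NumberField IsDedekindDomain Field WeierstrassCurve
open Literature.NumberTheory.EllipticCurves Literature.NumberTheory.GaloisRepresentations
  Literature.NumberTheory.EllipticCurves.Rank1Residual

namespace Literature.NumberTheory.EllipticCurves.GreenbergVatsal2000

/-- **Greenberg–Vatsal 2000, §2 p. 28 with the proof on p. 30: for an EVEN rational line `Φ`,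
`ε : H¹(ℚ_Σ/ℚ_∞, E[p]) → H¹(ℚ_Σ/ℚ_∞, Ψ)` is onto — every class of `U` lifts.** p. 28: "Later we will
show that `H²(ℚ_Σ/ℚ_∞, Φ) = 0`. Therefore, we have an exact sequence
`0 → H¹(ℚ_Σ/ℚ_∞, Φ) → H¹(ℚ_Σ/ℚ_∞, E[p]) →ε H¹(ℚ_Σ/ℚ_∞, Ψ) → 0`. … where
`U = ker(H¹(ℚ_Σ/ℚ_∞, Ψ) → H¹(I_p, Ψ))`"; p. 30: "We must just explain why `H²(ℚ_Σ/ℚ_∞, Φ) = 0`. …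
Since `X^φ_∞` is `Λ`-torsion (because `φ` is even), it follows that `S_A(ℚ_∞)` and
`S^{Σ₀}_A(ℚ_∞) = H¹(ℚ_Σ/ℚ_∞, A)` are `Λ`-cotorsion. Their `μ`-invariants are zero, by the
Ferrero-Washington theorem. By proposition (2.5), `S^{Σ₀}_A(ℚ_∞)^` has no nonzero, finite
`Λ`-submodules … `H¹(ℚ_Σ/ℚ_∞, A)` is divisible. … By proposition 4 of [Gre99], it follows that
`H²(ℚ_Σ/ℚ_∞, A) = 0`. Then the exact sequence `0 → Φ → A →p A → 0` induces an isomorphism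
`H¹(ℚ_Σ/ℚ_∞, A)/pH¹(ℚ_Σ/ℚ_∞, A) ≅ H²(ℚ_Σ/ℚ_∞, Φ)`. The vanishing of `H²(ℚ_Σ/ℚ_∞, Φ)` follows from
this." READING FLAG: p. 28's standing reduction is "`φ` is ramified and even"; the proof of `H² = 0` on
p. 30 invokes only the EVENNESS of `φ` (and `Ram(A_φ) ⊆ Σ`), so the lifting is recorded here for an
even line of ANY ramification at `p` — the case of the branch-parity line at an additive `p = 3`.
TRANSCRIPTION (as the sibling `residualEpsilon_surjOn_of_lineRamifiedEven` minus its hypothesis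
`¬ LineUnramifiedAt`): for `E/ℚ` on a globally minimal model, `p ≠ 2`, `κ` the cyclotomic
`ℤ_p`-extension, `Φ₀ ≤ E[p]` a rational line, EVEN, `S₀ ∌ p` finite containing the bad places `≠ p`:
every element of `residualQuotSelmer` (`U ∩ H¹(ℚ_Σ/ℚ_∞, Ψ)`) is `ε x` for some
`x ∈ residualTorsionH1` (`H¹(ℚ_Σ/ℚ_∞, E[p])`). Named reading-fact; nothing asserted.
-- TODO(general form): GV prove `H²(ℚ_Σ/ℚ_∞, Φ) = 0` (p. 30), i.e. surjectivity of `ε` onto all of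
-- `H¹(ℚ_Σ/ℚ_∞, Ψ)`, for every even character `φ` with `Ram(φ) ⊆ Σ`; only the consequence on `U`
-- (the lifting used in display (16)) is filed, for a rational line of an elliptic curve.
[cite: GreenbergVatsal2000, §2 p. 28 (exact sequence for H¹(ℚ_Σ/ℚ_∞, ·)) with p. 30 (proof that H²(ℚ_Σ/ℚ_∞, Φ) = 0, "because φ is even") and p. 29 (the even case: W_p = V_p, Ferrero–Washington)] -/
def residualEpsilon_surjOn_of_lineEven : Prop :=
  ∀ (W : WeierstrassCurve ℚ) [W.IsGloballyMinimal] [W.IsElliptic] (p : ℕ) [Fact p.Prime]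
    (κ : ZpExtension ℚ p) (S₀ : Finset (HeightOneSpectrum (𝓞 ℚ)))
    (Φ₀ : AddSubgroup (W.geomTorsion (p : ℤ))) (hΦ : IsRationalLine W p Φ₀),
    p ≠ 2 → κ.IsCyclotomic → LineEven W p Φ₀ →
    (∀ v ∈ S₀, ((p : ℕ) : 𝓞 ℚ) ∉ v.asIdeal) →
    (∀ v : HeightOneSpectrum (𝓞 ℚ), v ∉ S₀ → ((p : ℕ) : 𝓞 ℚ) ∉ v.asIdeal →
      W.HasGoodReductionAt v) →
    ∀ s ∈ residualQuotSelmer W p κ S₀ Φ₀ hΦ, ∃ x ∈ residualTorsionH1 W p κ S₀,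
      residualEpsilon W p κ Φ₀ hΦ x = s

/-- The ramified-even record is the special case of the even record (bookkeeping: the sibling's
hypothesis `¬ LineUnramifiedAt` is simply not used). [cite: GreenbergVatsal2000, §2 p. 28 with p. 30] -/
theorem residualEpsilon_surjOn_of_lineRamifiedEven_of_lineEven
    (h : residualEpsilon_surjOn_of_lineEven) : residualEpsilon_surjOn_of_lineRamifiedEven :=
  fun W _ _ p _ κ S₀ Φ₀ hΦ hp hκ _ heven hS₀ hS ↦ h W p κ S₀ Φ₀ hΦ hp hκ heven hS₀ hS

end Literature.NumberTheory.EllipticCurves.GreenbergVatsal2000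

end
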